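import Summits.HubbardSuperconductivity.HubbardSuperconductivity.Theorems.AnisotropyChordTransferFibre3N1RowTrueVecTail
import Summits.HubbardSuperconductivity.HubbardSuperconductivity.Theorems.AnisotropyChordTransferFibre3F2Decomp

/-!
# Route `AnisotropyChord` / H0 rotor rung, LEVEL 2 row `N₁`: the per-momentum DICTIONARY at the true vector

For the object layer of the cell-check soundness (B̂, P̂, Â, Q̂₁, Ĵ₁ ∈ their `RExpr` brackets at `X = xTrue L Δ λ₂ f a`,
`a = Δf(x̂)`), every per-momentum term of parts 1–4 must be identified with the model quantity at `k = toTor q`, `q` a grid point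
(`|q|∞ ≤ 3`, `q ≠ 0`), `θ = 2π/L`:
`vG ↦ θ²g(k)` (`eval_vG`), `vTt ↦ θ²t(k)` (`eval_vTt`), `ch ↦ θ²c(k)` (`eval_ch`), `ach ↦ θ²(2c_sg + d)`, `bh ↦ θ²β(k)`,
`Eh ↦ 2ε_T(k)/θ²` (`eval_Eh`), `F0h ↦ θ²F₂(0)` (`eval_F0h`, via `F2ClosedPlusTail`: `F₂(0) = V + ‖h‖²`), `tnamed ↦ θ²t(k)` at the
eight named momenta (`eval_tnamed`, via `TfunNamed`), hence ★ `eval_Fh`: `Fh ↦ θ²F₂(k)` on the whole grid (`F₂ = c + t`).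
Grid bookkeeping by `decide` (`named_of_grid`, `toTor` of the eight named points).
Prover seat `hubbard-h0-rotor-p2` g4; helper for piece A = stmt-HubbardSuperconductivity-23918 of rung 19089
(`--supports`, helper class).  Nothing here proves superconductivity in the Hubbard model; helper lemmas of ONE conditional
reduction (the GM₃ ∀L certificate, Level-2 row `N₁`); the rotor TARGET as originally worded stays FALSE (g15 verdict).
Mathlib + the tree only; no sorry.
-/

set_option linter.dupNamespace false
set_option autoImplicit false

open Literature.Analysis.ValidatedNumerics

namespace Summit.HubbardSuperconductivity.HubbardSuperconductivity.Theorems.AnisotropyChord.Transfer.Fibre3.L2.N1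

variable (L : ℕ) [NeZero L] (Δ lam2 : ℝ) (f : Tor L → ℝ)

/-! ## Grid bookkeeping -/

/-- a grid point is some `G[i]`. -/
theorem exists_index_of_mem {q : ℤ × ℤ} (hq : q ∈ gridPts 3) :
    ∃ i, ∃ hi : i < 48, (gridPts 3)[i]'(by rw [length_gridPts_three]; exact hi) = q := by
  obtain ⟨i, hi, h⟩ := List.getElem_of_mem hq
  exact ⟨i, by rw [length_gridPts_three] at hi; exact hi, h⟩

/-- the named grid points are the eight nearest / diagonal neighbours. -/
theorem named_of_grid : ∀ q ∈ gridPts 3, isNamed q = true →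
    q ∈ [((1 : ℤ), (0 : ℤ)), (-1, 0), (0, 1), (0, -1), (1, 1), (1, -1), (-1, 1), (-1, -1)] := by decide

/-- grid points are nonzero. -/
theorem ne_zero_of_grid : ∀ q ∈ gridPts 3, q ≠ (0, 0) := by decide

/-! ## The base coordinates -/

/-- `θ²g(k)` at a grid point. -/
theorem eval_vG {q : ℤ × ℤ} (hq : q ∈ gridPts 3) (a : ℝ) :
    (vG 3 q).eval (xTrue L Δ lam2 f a) = (2 * Real.pi / L) ^ 2 * gres L lam2 (B1.toTor L q) := by
  obtain ⟨i, hi, hiq⟩ := exists_index_of_mem hq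
  have hidx : gridIdx 3 q = i := by rw [← hiq]; exact gridIdx_three i hi
  simp only [vG, RExpr.eval, hidx]
  rw [xTrue_ghat L Δ lam2 f a hi, hiq]

/-- `θ²t(k)` (the unknown tail coordinate) at a grid point. -/
theorem eval_vTt {q : ℤ × ℤ} (hq : q ∈ gridPts 3) (a : ℝ) :
    (vTt 3 q).eval (xTrue L Δ lam2 f a) = (2 * Real.pi / L) ^ 2 * tfun L Δ f (B1.toTor L q) := by
  obtain ⟨i, hi, hiq⟩ := exists_index_of_mem hq
  have hidx : gridIdx 3 q = i := by rw [← hiq]; exact gridIdx_three i hi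
  simp only [vTt, RExpr.eval, hidx, length_gridPts_three]
  rw [show 19 + 48 + i = 67 + i by omega, xTrue_tt L Δ lam2 f a hi, hiq]

/-! ## The closed parts -/

/-- `ch ↦ θ²c(k)`, `ach ↦ θ²(2c_sg(k) + d)`, `bh ↦ θ²β(k)` at a grid point (ground profile). -/
theorem eval_closed (hL : 5 ≤ L) (hΔ0 : 0 ≤ Δ) (hΔ1 : Δ < 1) (hf : IsGroundTwoMagnon L Δ lam2 f) (hlam : 0 < lam2)
    {q : ℤ × ℤ} (hq : q ∈ gridPts 3) :
    let X := xTrue L Δ lam2 f (Δ * f (K1 L))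
    let θ : ℝ := 2 * Real.pi / L
    (ch 3 q).eval X = θ ^ 2 * cK L Δ lam2 f (B1.toTor L q) ∧
    (ach 3 q).eval X = θ ^ 2 * (2 * cS L Δ lam2 f * gres L lam2 (B1.toTor L q) + dPar L Δ f) ∧
    (bh 3 q).eval X = θ ^ 2 * betaK L Δ lam2 f (B1.toTor L q) := by
  intro X θ
  obtain ⟨_, dcs, _, ddd, _⟩ := dict_at_xTrue L Δ lam2 f hL hΔ0 hΔ1 hf hlam
  have hG := eval_vG L Δ lam2 f hq (Δ * f (K1 L))
  have hX0 : X 0 = θ ^ 2 := xTrue_zero L Δ lam2 f _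
  refine ⟨?_, ?_, ?_⟩
  · simp only [ch, RExpr.eval, cst, vT]
    rw [dcs, ddd, hG, hX0]; unfold cK dPar; push_cast; ring
  · simp only [ach, RExpr.eval, cst, vT]
    rw [dcs, ddd, hG, hX0]; unfold dPar; push_cast; ring
  · simp only [bh, RExpr.eval, cst, vT]
    rw [dcs, ddd, hG, hX0]; unfold betaK dPar; push_cast; ring

/-- `Eh ↦ 2ε_T(k)/θ²` at a grid point (`k ≠ 0`, `2ε_T(k) ≠ λ₂`). -/
theorem eval_Eh (hL : 4 ≤ L) (hlam : 0 < lam2) (h2 : 2 * lam2 < eps1 L) {q : ℤ × ℤ} (hq : q ∈ gridPts 3) (a : ℝ) :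
    (Eh 3 q).eval (xTrue L Δ lam2 f a) = 2 * epsT L (B1.toTor L q) / (2 * Real.pi / L) ^ 2 := by
  have hG := eval_vG L Δ lam2 f hq a
  have hLpos : (0 : ℝ) < L := by exact_mod_cast (show 0 < L by omega)
  have hθ2 : (2 * Real.pi / (L : ℝ)) ^ 2 ≠ 0 := by positivity
  have hk : B1.toTor L q ≠ 0 := by
    have := B1.intCast_ne_zero_of_mem_zWindow L 3 (by omega) q (gridPts_three_window q hq)
    simpa [B1.toTor] using this
  have hε : eps1 L ≤ epsT L (B1.toTor L q) := eps1_le_epsT L (by omega) hk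
  have hg : gres L lam2 (B1.toTor L q) = 1 / (2 * epsT L (B1.toTor L q) - lam2) := by unfold gres; rw [if_neg hk]
  have hden : 2 * epsT L (B1.toTor L q) - lam2 ≠ 0 := by linarith
  have hX2 : xTrue L Δ lam2 f a 2 = lam2 / (2 * Real.pi / L) ^ 2 := by
    rw [xTrue_lt16 L Δ lam2 f a (by norm_num)]; rfl
  simp only [Eh, RExpr.eval, cst, vNu]
  rw [hG, hX2, hg]; push_cast
  field_simp
  ring

/-- `F0h ↦ θ²F₂(0)` (ground profile; `F₂(0) = V + ‖h‖²`). -/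
theorem eval_F0h (hL : 5 ≤ L) (hΔ0 : 0 ≤ Δ) (hΔ1 : Δ < 1) (hf : IsGroundTwoMagnon L Δ lam2 f) (hlam : 0 < lam2) :
    F0h.eval (xTrue L Δ lam2 f (Δ * f (K1 L))) = (2 * Real.pi / L) ^ 2 * F2 L f 0 := by
  set X := xTrue L Δ lam2 f (Δ * f (K1 L)) with hXdef
  obtain ⟨_, _, _, ddd, dsig⟩ := dict_at_xTrue L Δ lam2 f hL hΔ0 hΔ1 hf hlam
  obtain ⟨h0, _⟩ := OuterMaj.f2ClosedPlusTail_holds L hL hΔ0 lam2 f hf hlam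
  have hLpos : (0 : ℝ) < L := by exact_mod_cast (show 0 < L by omega)
  have hX0 : X 0 = (2 * Real.pi / L) ^ 2 := xTrue_zero L Δ lam2 f _
  have hX1 : X 1 = Real.pi ^ 2 := by rw [hXdef, xTrue_lt16 L Δ lam2 f _ (by norm_num)]; rfl
  have hX3 : X 3 = Δ * f (K1 L) := by rw [hXdef, xTrue_lt16 L Δ lam2 f _ (by norm_num)]; rfl
  simp only [F0h, RExpr.eval, cst, vT, vPi2, vA]
  rw [ddd, dsig, hX0, hX1, hX3, h0]
  unfold nf2V aPar
  push_cast
  field_simp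
  ring

/-! ## The named tails and `F̂` -/

/-- the eight named points as torus elements. -/
theorem toTor_named (L : ℕ) [NeZero L] :
    B1.toTor L (1, 0) = ex L ∧ B1.toTor L (-1, 0) = -ex L ∧ B1.toTor L (0, 1) = ey L ∧ B1.toTor L (0, -1) = -ey L ∧
    B1.toTor L (1, 1) = ex L + ey L ∧ B1.toTor L (1, -1) = ex L - ey L ∧ B1.toTor L (-1, 1) = -ex L + ey L ∧
    B1.toTor L (-1, -1) = -ex L - ey L := by
  simp [B1.toTor, ex, ey]

/-- `tnamed ↦ θ²t(k)` at a named grid point (ground profile, `TfunNamed`). -/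
theorem eval_tnamed (hL : 5 ≤ L) (hΔ0 : 0 ≤ Δ) (hΔ1 : Δ < 1) (hf : IsGroundTwoMagnon L Δ lam2 f) (hlam : 0 < lam2)
    {q : ℤ × ℤ} (hq : q ∈ gridPts 3) (hn : isNamed q = true) :
    (tnamed 3 q).eval (xTrue L Δ lam2 f (Δ * f (K1 L))) = (2 * Real.pi / L) ^ 2 * tfun L Δ f (B1.toTor L q) := by
  set X := xTrue L Δ lam2 f (Δ * f (K1 L)) with hXdef
  obtain ⟨_, dcs, _, _, _⟩ := dict_at_xTrue L Δ lam2 f hL hΔ0 hΔ1 hf hlam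
  obtain ⟨hax, hdiag⟩ := tfunNamed_holds L hL hΔ0 lam2 f hf hlam
  have hG := eval_vG L Δ lam2 f hq (Δ * f (K1 L))
  have hLpos : (0 : ℝ) < L := by exact_mod_cast (show 0 < L by omega)
  have hX0 : X 0 = (2 * Real.pi / L) ^ 2 := xTrue_zero L Δ lam2 f _
  have hX1 : X 1 = Real.pi ^ 2 := by rw [hXdef, xTrue_lt16 L Δ lam2 f _ (by norm_num)]; rfl
  have hX3 : X 3 = Δ * f (K1 L) := by rw [hXdef, xTrue_lt16 L Δ lam2 f _ (by norm_num)]; rfl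
  have hX7 : X 7 = (2 * Real.pi / L) ^ (2 * 2) * T10n L lam2 := by rw [hXdef, xTrue_lt16 L Δ lam2 f _ (by norm_num)]; rfl
  have hX8 : X 8 = (2 * Real.pi / L) ^ (2 * 2) * T11n L lam2 := by rw [hXdef, xTrue_lt16 L Δ lam2 f _ (by norm_num)]; rfl
  obtain ⟨t1, t2, t3, t4, t5, t6, t7, t8⟩ := toTor_named L
  have hmem := named_of_grid q hq hn
  -- the value of `T̂(q)`: axis ↦ `T10`, diagonal ↦ `T11`, and the model formula for `t(k)`
  have key : ∃ T : ℝ, (if q.1.natAbs + q.2.natAbs = 1 then vT10 else vT11 : RExpr).eval X = (2 * Real.pi / L) ^ (2 * 2) * T ∧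
      tfun L Δ f (B1.toTor L q) = (cS L Δ lam2 f ^ 2 * T
        - 2 * aPar L Δ f * cS L Δ lam2 f * gres L lam2 (B1.toTor L q)) / (L : ℝ) ^ 2 := by
    simp only [List.mem_cons, List.mem_nil_iff, or_false] at hmem
    rcases hmem with h | h | h | h | h | h | h | h <;> subst h
    · exact ⟨T10n L lam2, by simp [vT10, RExpr.eval, hX7], by rw [t1]; exact hax _ (by simp)⟩
    · exact ⟨T10n L lam2, by simp [vT10, RExpr.eval, hX7], by rw [t2]; exact hax _ (by simp)⟩
    · exact ⟨T10n L lam2, by simp [vT10, RExpr.eval, hX7], by rw [t3]; exact hax _ (by simp)⟩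
    · exact ⟨T10n L lam2, by simp [vT10, RExpr.eval, hX7], by rw [t4]; exact hax _ (by simp)⟩
    · exact ⟨T11n L lam2, by simp [vT11, RExpr.eval, hX8], by rw [t5]; exact hdiag _ (by simp)⟩
    · exact ⟨T11n L lam2, by simp [vT11, RExpr.eval, hX8], by rw [t6]; exact hdiag _ (by simp)⟩
    · exact ⟨T11n L lam2, by simp [vT11, RExpr.eval, hX8], by rw [t7]; exact hdiag _ (by simp)⟩
    · exact ⟨T11n L lam2, by simp [vT11, RExpr.eval, hX8], by rw [t8]; exact hdiag _ (by simp)⟩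
  obtain ⟨T, hT, htf⟩ := key
  have e : (tnamed 3 q).eval X = (cs.eval X ^ 2 * (if q.1.natAbs + q.2.natAbs = 1 then vT10 else vT11 : RExpr).eval X
      - 2 * X 3 * cs.eval X * (vG 3 q).eval X * X 0) * (4 * X 1)⁻¹ := by
    simp only [tnamed, RExpr.eval, cst, vA, vT, vPi2]
    split <;> (push_cast; ring)
  rw [e, hT, dcs, hG, hX0, hX1, hX3, htf]
  unfold aPar
  have ht : (2 * Real.pi / (L : ℝ)) ^ 2 = 4 * Real.pi ^ 2 / (L : ℝ) ^ 2 := by rw [div_pow]; ring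
  have ht4 : (2 * Real.pi / (L : ℝ)) ^ (2 * 2) = (4 * Real.pi ^ 2 / (L : ℝ) ^ 2) ^ 2 := by rw [pow_mul, ht]
  rw [ht4, ht]
  field_simp

/-- ★ `Fh ↦ θ²F₂(k)` at every grid point (ground profile, `L ≥ 5`, `0 ≤ Δ < 1`, `0 < λ₂`; `F₂ = c + t` off the origin). -/
theorem eval_Fh (hL : 5 ≤ L) (hΔ0 : 0 ≤ Δ) (hΔ1 : Δ < 1) (hf : IsGroundTwoMagnon L Δ lam2 f) (hlam : 0 < lam2)
    {q : ℤ × ℤ} (hq : q ∈ gridPts 3) :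
    (Fh 3 q).eval (xTrue L Δ lam2 f (Δ * f (K1 L))) = (2 * Real.pi / L) ^ 2 * F2 L f (B1.toTor L q) := by
  have hk : B1.toTor L q ≠ 0 := by
    have := B1.intCast_ne_zero_of_mem_zWindow L 3 (by omega) q (gridPts_three_window q hq)
    simpa [B1.toTor] using this
  obtain ⟨_, hF⟩ := OuterMaj.f2ClosedPlusTail_holds L hL hΔ0 lam2 f hf hlam
  obtain ⟨hc, _, _⟩ := eval_closed L Δ lam2 f hL hΔ0 hΔ1 hf hlam hq
  rw [hF _ hk, mul_add, ← hc]
  unfold Fh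
  by_cases hn : isNamed q = true
  · rw [if_pos hn]; simp only [RExpr.eval]
    rw [eval_tnamed L Δ lam2 f hL hΔ0 hΔ1 hf hlam hq hn]
  · rw [if_neg hn]; simp only [RExpr.eval]
    rw [eval_vTt L Δ lam2 f hq]

end Summit.HubbardSuperconductivity.HubbardSuperconductivity.Theorems.AnisotropyChord.Transfer.Fibre3.L2.N1
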